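import Summits.BirchSwinnertonDyer.BirchSwinnertonDyer.Theorems.SchneiderFreeAdditiveX3JointUpperManin
import Literature.NumberTheory.EllipticCurves.Rank1Residual.Typed.Basic
import HarnessLib

/-!
# Rank-one descent at an additive prime from the EXACT Heegner index (Manin-robust): both joint halves over
# `(E, E^{d_K})`, and `BSD_p(E^{d_K}) ⟹ BSD_p(E)` — the terminal step of the W-ALL kernel
# `ToricKernelAtThree` at the wild `3` (item stmt-BirchSwinnertonDyer-20390)

Seat `bsd-potss-kmc`, gen 17 (cell `bsd-potss`; service on bsd-wall-pss3's route `UniversalToricDescent`,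
leaf `WAllExclAddWildRankOne` = the content of this seat's residual K9 19200). ROUTE-FREE module
(imports no `Theses.*`); GENERIC in the prime `p ∣ N`, `p` odd — nothing here is special to `3` or to
the wild class.

The UTD kernel (support item 20390, «JSW §7.4 at the wild split prime `3`, Manin-robust») ends with:
«with the unit value and exact control, `ord₃#Ш(E/K) = 2·ord₃[E(K):ℤP] − 2·ord₃ c − 2·ord₃∏c_ℓ`; Gross–Zagier
with `‖f‖` keeps the same `2·ord₃ c`, the twist's BSD₃ and `L(E/K) = L(E)L(E^(d_K))` descend to BSD₃(E) as in
`X11b.bsdp_of_indexIdentityAt` without its `3 ∤ c` binder». In the tree's Manin-robust currency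
(cell `bsd-schneider-ideate`, route K1 `SchneiderFreeAdditiveX3`: `SchneiderFree.IndexLowerBoundLeAt` /
`SchneiderFree.Upper.IndexUpperBoundLeAt` at slack `s = v_p(c)`, `Typed.JointLowerBoundAt` /
`SchneiderFree.Upper.JointUpperBoundAt`) that terminal step is THIS file:

* `jointLowerBoundAt_of_stepL_manin` — STEP L at slack `v_p(c)` ⟹ the JOINT lower half over `(W, Wd)`;
  the route-free twin of K1's CLOSED item `JointLowerManin` (19180,
  `schneiderFreeAdditiveX3_jointLowerManin_proof`, whose module imports K1's route file), proved exactly as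
  its mirror `SchneiderFree.Upper.jointUpperBoundAt_of_coStepL_manin` with the inequality reversed: the
  exact identity `SchneiderFree.exists_shaAn_padicVal_eq_of_heegner_manin`
  (`ord q + ord q_d + ord ∏c(E) + 2 ord #E^d(ℚ)_tors + 2 v_p(c) + v_p(u) = 2 ord [E(K):ℤP]`), Gross–Zagier
  I.(7.3) for the twist's value, `#Ш_an(E^d) = q_d·#tors²/∏c(E^d)` (`Wuthrich2014.shaAn_eq_of_L_one_div_eq`)
  and the two transports as EQUALITIES (`X2.padicValNat_tamagawaProduct_twist_of_heegner_of_odd`,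
  `AdditivePotMult.padicValRat_u_eq_zero_of_twist_minimal_of_split` — the latter needs `p ∣ N`);
* **`bsdp_of_exactIndexManin_of_partner_bsdp`** — for `E/ℚ` (globally minimal `W`) of analytic rank
  one, an odd `p ∣ N`, a Heegner datum `(N, K, Dt, H, ι, P)` with `d_K` odd, `p ∤ #𝓞_K^×`,
  `L(E^{d_K},1) ≠ 0`, and ANY globally minimal model `Wd` of `E^{d_K}`: the EXACT index at slack `v_p(c)`
  (`IndexLowerBoundLeAt ∧ Upper.IndexUpperBoundLeAt`) together with `BSDp Wd p` (the rank-zero partner)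
  give `BSDp W p` — joint lower + partner's upper ⟹ lower (`Typed.missingLowerBoundAt_of_joint_of_upper`),
  joint upper + partner's lower ⟹ upper (`Upper.missingUpperBoundAt_of_jointUpper_of_lower`), the two
  halves ⟹ `MissingPPartAt` ⟹ `BSDp` (`Typed.bsdp_of_missingPPartAt`, Gross–Zagier–Kolyvagin);
* `bsdp_of_exactIndexManin_of_partner_halves` — the same with the partner's two halves as inputs.

What the UTD kernel still has to supply upstream of this file: the data (Friedberg–Hoffstein `K` with odd
`d_K`, `3` split, `L(E^{d_K},1) ≠ 0`; `3 ∤ #𝓞_K^×` is automatic since `3` splits in `K`), the EXACT index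
at slack `v₃(c)` from its cruxes (IMC equality by transport + unit Waldspurger value + the control count
`WildSplitControlAtThree` at `𝔭′`, with `ord₃ log_{𝔭′} P = ord₃ log_𝔭 P` = K1's
`SchneiderFreeAdditiveX3LogOmegaConjugatePrime.sq_logOmega_embAt_eq_of_rank_one`, and the sockets
`SchneiderFree.Upper` §Links), and `BSDp Wd 3` from `WildRankZeroTwistAtThree` (the twist is again wild
at `3`). CONDITIONAL on the named facts carried as hypotheses (Gross–Zagier I.(6.3), Kolyvagin, GZK,
modularity, Gross–Zagier I.(7.3)); closes nothing by itself; BSD is not proved by any of this.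

References: [GrossZagier1986] Thm. I.(6.3), (7.3); [JetchevSkinnerWan2017] §7.4.1 (arXiv:1512.06894 p. 30);
[Miller2011LMS] Def. 1.1; [Kolyvagin1990] Thm. A.
-/

noncomputable section

open scoped Classical

open WeierstrassCurve NumberField IsDedekindDomain Field Literature.NumberTheory.EllipticCurves
  Literature.NumberTheory.EllipticCurves.ModularForms
  Literature.NumberTheory.EllipticCurves.GreenbergSelmer
  Literature.NumberTheory.EllipticCurves.Rank1Residual
  Literature.NumberTheory.EllipticCurves.Rank1Residual.Typed
  Literature.NumberTheory.EllipticCurves.KellerYin2024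
  Summit.BirchSwinnertonDyer.Rank1Residual
  Summit.BirchSwinnertonDyer.Rank1Residual.X11b
  Summit.BirchSwinnertonDyer.Rank1Residual.X11b.AcSelmer
  Summit.BirchSwinnertonDyer.Rank1Residual.X11b.Halves

set_option linter.dupNamespace false
set_option autoImplicit false

namespace Summit.BirchSwinnertonDyer.BirchSwinnertonDyer.Theorems.SchneiderFree.Exact

/-! ### §1 Gross–Zagier bookkeeping: STEP L at slack `v_p(c)` ⟹ the JOINT lower half (route-free twin of item 19180) -/

/-- **STEP L at slack `v_p(c)` ⟹ JOINT lower, route-free** — the twin of K1's CLOSED item `JointLowerManin`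
(19180) and the mirror of `SchneiderFree.Upper.jointUpperBoundAt_of_coStepL_manin`: the exact identity
`exists_shaAn_padicVal_eq_of_heegner_manin`, Gross–Zagier I.(7.3) for the twist's value,
`#Ш_an(E^d) = q_d·#tors²/∏c(E^d)`, and the two twist transports as equalities (`p` odd, `p ∣ N` split in
`K`); the `2·v_p(c)` cancel. Facts by name as hypotheses.
[cite: GrossZagier1986, Thm. I.(6.3) and (7.3)] [cite: JetchevSkinnerWan2017, §7.4.1 (arXiv:1512.06894 p. 30)] -/
theorem jointLowerBoundAt_of_stepL_manin
    (hGZ : ∀ (N : ℕ) [NeZero N] (W : WeierstrassCurve ℚ) (K : Type) [Field K] [NumberField K],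
      gross_zagier N W K)
    (hKo : ∀ (N : ℕ) [NeZero N] (W : WeierstrassCurve ℚ) (K : Type) [Field K] [NumberField K],
      kolyvagin N W K)
    (hGZK : rank_eq_analyticRank_of_analyticRank_le_one) (hmod : hasEntireLFunction_rat)
    (hGZ73 : GrossZagier1986_thm_I_7_3)
    (W : WeierstrassCurve ℚ) [W.IsElliptic] [W.IsGloballyMinimal] (p : ℕ) [Fact p.Prime]
    (N : ℕ) [NeZero N] (K : Type) [Field K] [NumberField K]
    (Dt : ModularParametrizationData W N) (H : HeegnerDatum N (NumberField.discr K)) (ι : K →+* ℂ)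
    (P : (W.baseChange K).toAffine.Point) (Wd : WeierstrassCurve ℚ) [Wd.IsElliptic] [Wd.IsGloballyMinimal]
    (hr : W.analyticRank = 1) (hN : W.conductorNorm ℤ = N) (hpN : p ∣ N) (hK : IsImaginaryQuadratic K)
    (hodd : Odd (NumberField.discr K)) (hw : ¬ p ∣ Units.torsionOrder K)
    (hHH : SatisfiesHeegnerHypothesis N K)
    (hLd : (W.quadraticTwist (NumberField.discr K : ℚ)).entireLFunction 1 ≠ 0)
    (hP : WeierstrassCurve.Affine.Point.map ι.toRatAlgHom P = heegnerPointComplex Dt H)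
    (hC : ∃ C : VariableChange ℚ, C • W.quadraticTwist (NumberField.discr K : ℚ) = Wd)
    (hp2 : p ≠ 2) (hI : IndexLowerBoundLeAt W p K P (padicValNat p Dt.c.natAbs)) :
    JointLowerBoundAt W Wd p := by
  have hpp : p.Prime := Fact.out
  obtain ⟨Cd, hWd⟩ := hC
  -- the twist's algebraic central value (Gross–Zagier I.(7.3))
  obtain ⟨qd, hqd⟩ := SchneiderFree.exists_rat_twist_L_one_div_realPeriod_of_heegner W N K Dt H ι P
    (hGZ N W K) (hKo N W K) hGZK hmod hGZ73 hK hHH hP hr hLd Wd Cd hWd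
  -- the Manin-robust bookkeeping identity (an EQUALITY: it serves both wings)
  obtain ⟨-, -, hsha, q, hq, hval⟩ := SchneiderFree.exists_shaAn_padicVal_eq_of_heegner_manin W p N K
    Dt H ι P (hGZ N W K) (hKo N W K) hGZK hmod hK hHH hP hp2 hw hr hLd Wd Cd hWd qd hqd
  -- `#Ш_an(E^{d_K})` in rank zero
  have hD0 : (NumberField.discr K : ℚ) ≠ 0 := by exact_mod_cast NumberField.discr_ne_zero K
  haveI : (W.quadraticTwist (NumberField.discr K : ℚ)).IsElliptic := W.isElliptic_quadraticTwist hD0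
  have hLd1 : Wd.entireLFunction 1 ≠ 0 := by rw [← hWd, entireLFunction_smul]; exact hLd
  obtain ⟨-, hfin, -, hshaAnd⟩ := Wuthrich2014.shaAn_eq_of_L_one_div_eq hGZK Wd hLd1 hqd
  haveI := hfin
  have htdeq : Wd.torsionOrder = Nat.card Wd.toAffine.Point := Wd.torsionOrder_eq_natCard_of_finite
  -- the two transports, as EQUALITIES (`p` odd, `p ∣ N` split in `K`)
  have hHN' : SatisfiesHeegnerHypothesis (W.conductorNorm ℤ) K := by rw [hN]; exact hHH
  have hHp : SatisfiesHeegnerHypothesis p K := SatisfiesHeegnerHypothesis.of_dvd hpN hHH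
  have hpd : ¬ (p : ℤ) ∣ NumberField.discr K :=
    X11b.Three.not_dvd_discr_of_ncard_primesOver_eq_two hK.1 hp2 (hHH p hpp hpN)
  have htam := X2.padicValNat_tamagawaProduct_twist_of_heegner_of_odd W p hp2 K hK hodd hpd hHN' Cd hWd
  have hu := AdditivePotMult.padicValRat_u_eq_zero_of_twist_minimal_of_split W p K hK hHp Cd hWd
  -- the joint lower half
  refine ⟨q, qd * (Nat.card Wd.toAffine.Point : ℚ) ^ 2 / (Wd.tamagawaProduct : ℚ), hq, hshaAnd, ?_⟩
  have hqd0 : qd ≠ 0 := by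
    intro h0
    apply hLd1
    have hΩ : (Wd.realPeriodRat : ℂ) ≠ 0 := by exact_mod_cast Wd.realPeriodRat_pos_holds.ne'
    rw [h0, Rat.cast_zero, div_eq_zero_iff] at hqd
    exact hqd.resolve_right hΩ
  have htd0 : (Nat.card Wd.toAffine.Point : ℚ) ≠ 0 := by exact_mod_cast (Nat.card_pos).ne'
  have hcd0 : (Wd.tamagawaProduct : ℚ) ≠ 0 := by exact_mod_cast Wd.tamagawaProduct_pos_holds.ne'
  have hvd : padicValRat p (qd * (Nat.card Wd.toAffine.Point : ℚ) ^ 2 / (Wd.tamagawaProduct : ℚ)) =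
      padicValRat p qd + 2 * padicValNat p Wd.torsionOrder - padicValNat p Wd.tamagawaProduct := by
    rw [padicValRat.div (mul_ne_zero hqd0 (pow_ne_zero _ htd0)) hcd0, padicValRat.mul hqd0 (pow_ne_zero _ htd0),
      padicValRat.pow, padicValRat.of_nat, padicValRat.of_nat, htdeq]
    push_cast; ring
  rw [hvd]
  unfold IndexLowerBoundLeAt at hI
  have e1 : 2 * (padicValNat p (AddSubgroup.zmultiples P).index : ℤ) ≤
      (padicValNat p (W.baseChange K).shaOrder : ℤ) + 2 * padicValNat p W.tamagawaProduct +
      2 * padicValNat p Dt.c.natAbs := by exact_mod_cast hI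
  have e2 : (padicValNat p (W.baseChange K).shaOrder : ℤ) =
      padicValNat p W.shaOrder + padicValNat p Wd.shaOrder := by exact_mod_cast hsha
  have e3 : (padicValNat p Wd.tamagawaProduct : ℤ) = padicValNat p W.tamagawaProduct := by exact_mod_cast htam
  linarith

/-! ### §2 The rank-one descent: exact index + the partner's `p`-part ⟹ `BSD_p(E)` -/

/-- **Exact Heegner index at slack `v_p(c)` + the two halves of the rank-zero partner ⟹ `BSD_p(E)`.** For
`E/ℚ` (globally minimal `W`) with `r_an = 1`, an odd `p ∣ N`, a Heegner datum with `d_K` odd, `p ∤ #𝓞_K^×`,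
`L(E^{d_K},1) ≠ 0` and any globally minimal `Wd ≅ E^{d_K}`: STEP L and co-STEP L at slack `v_p(c)` give the
two JOINT halves over `(W, Wd)` (`jointLowerBoundAt_of_stepL_manin`,
`SchneiderFree.Upper.jointUpperBoundAt_of_coStepL_manin`); the partner's upper (resp. lower) half peels off
the LOWER (resp. UPPER) half of `W` (`Typed.missingLowerBoundAt_of_joint_of_upper`,
`SchneiderFree.Upper.missingUpperBoundAt_of_jointUpper_of_lower`); both halves are `MissingPPartAt W p`, which
with Gross–Zagier–Kolyvagin is `BSDp W p` (`Typed.bsdp_of_missingPPartAt`). Facts by name as hypotheses;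
nothing is asserted about any crux. [cite: GrossZagier1986, Thm. I.(6.3) and (7.3)]
[cite: JetchevSkinnerWan2017, §7.4.1 (arXiv:1512.06894 p. 30)] [cite: Miller2011LMS, Def. 1.1] -/
theorem bsdp_of_exactIndexManin_of_partner_halves
    (hGZ : ∀ (N : ℕ) [NeZero N] (W : WeierstrassCurve ℚ) (K : Type) [Field K] [NumberField K],
      gross_zagier N W K)
    (hKo : ∀ (N : ℕ) [NeZero N] (W : WeierstrassCurve ℚ) (K : Type) [Field K] [NumberField K],
      kolyvagin N W K)
    (hGZK : rank_eq_analyticRank_of_analyticRank_le_one) (hmod : hasEntireLFunction_rat)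
    (hGZ73 : GrossZagier1986_thm_I_7_3)
    (W : WeierstrassCurve ℚ) [W.IsElliptic] [W.IsGloballyMinimal] (p : ℕ) [Fact p.Prime]
    (N : ℕ) [NeZero N] (K : Type) [Field K] [NumberField K]
    (Dt : ModularParametrizationData W N) (H : HeegnerDatum N (NumberField.discr K)) (ι : K →+* ℂ)
    (P : (W.baseChange K).toAffine.Point) (Wd : WeierstrassCurve ℚ) [Wd.IsElliptic] [Wd.IsGloballyMinimal]
    (hr : W.analyticRank = 1) (hN : W.conductorNorm ℤ = N) (hpN : p ∣ N) (hK : IsImaginaryQuadratic K)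
    (hodd : Odd (NumberField.discr K)) (hw : ¬ p ∣ Units.torsionOrder K)
    (hHH : SatisfiesHeegnerHypothesis N K)
    (hLd : (W.quadraticTwist (NumberField.discr K : ℚ)).entireLFunction 1 ≠ 0)
    (hP : WeierstrassCurve.Affine.Point.map ι.toRatAlgHom P = heegnerPointComplex Dt H)
    (hC : ∃ C : VariableChange ℚ, C • W.quadraticTwist (NumberField.discr K : ℚ) = Wd)
    (hp2 : p ≠ 2) (hlo : IndexLowerBoundLeAt W p K P (padicValNat p Dt.c.natAbs))
    (hup : Upper.IndexUpperBoundLeAt W p K P (padicValNat p Dt.c.natAbs))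
    (hdlo : MissingLowerBoundAt Wd p) (hdup : MissingUpperBoundAt Wd p) :
    BSDp W p := by
  have hJlo : JointLowerBoundAt W Wd p :=
    jointLowerBoundAt_of_stepL_manin hGZ hKo hGZK hmod hGZ73 W p N K Dt H ι P Wd hr hN hpN hK hodd hw hHH
      hLd hP hC hp2 hlo
  have hJup : Upper.JointUpperBoundAt W Wd p :=
    Upper.jointUpperBoundAt_of_coStepL_manin hGZ hKo hGZK hmod hGZ73 W p N K Dt H ι P Wd hr hN hpN hK hodd
      hw hHH hLd hP hC hp2 hup
  have hlow : MissingLowerBoundAt W p := missingLowerBoundAt_of_joint_of_upper hJlo hdup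
  have hupp : MissingUpperBoundAt W p := Upper.missingUpperBoundAt_of_jointUpper_of_lower hJup hdlo
  exact bsdp_of_missingPPartAt W p hGZK (by rw [hr]) (missingPPartAt_of_lower_of_upper W p hlow hupp)

/-- **Exact Heegner index at slack `v_p(c)` + `BSD_p` of the rank-zero partner ⟹ `BSD_p(E)`** — the form the
UTD kernel consumes (`WildRankZeroTwistAtThree` delivers `BSDp Wd 3` for the twist, which is again wild at `3`
with `r_an = 0`): `BSDp Wd p` gives the partner's two halves (`Typed.missingPPartAt_of_bsdp`,
`Typed.lower_and_upper_of_missingPPartAt`; `Ш(Wd)` is finite by Gross–Zagier–Kolyvagin in rank zero), then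
`bsdp_of_exactIndexManin_of_partner_halves`. [cite: GrossZagier1986, Thm. I.(6.3) and (7.3)]
[cite: JetchevSkinnerWan2017, §7.4.1 (arXiv:1512.06894 p. 30)] [cite: Miller2011LMS, Def. 1.1] -/
theorem bsdp_of_exactIndexManin_of_partner_bsdp
    (hGZ : ∀ (N : ℕ) [NeZero N] (W : WeierstrassCurve ℚ) (K : Type) [Field K] [NumberField K],
      gross_zagier N W K)
    (hKo : ∀ (N : ℕ) [NeZero N] (W : WeierstrassCurve ℚ) (K : Type) [Field K] [NumberField K],
      kolyvagin N W K)
    (hGZK : rank_eq_analyticRank_of_analyticRank_le_one) (hmod : hasEntireLFunction_rat)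
    (hGZ73 : GrossZagier1986_thm_I_7_3)
    (W : WeierstrassCurve ℚ) [W.IsElliptic] [W.IsGloballyMinimal] (p : ℕ) [Fact p.Prime]
    (N : ℕ) [NeZero N] (K : Type) [Field K] [NumberField K]
    (Dt : ModularParametrizationData W N) (H : HeegnerDatum N (NumberField.discr K)) (ι : K →+* ℂ)
    (P : (W.baseChange K).toAffine.Point) (Wd : WeierstrassCurve ℚ) [Wd.IsElliptic] [Wd.IsGloballyMinimal]
    (hr : W.analyticRank = 1) (hN : W.conductorNorm ℤ = N) (hpN : p ∣ N) (hK : IsImaginaryQuadratic K)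
    (hodd : Odd (NumberField.discr K)) (hw : ¬ p ∣ Units.torsionOrder K)
    (hHH : SatisfiesHeegnerHypothesis N K)
    (hLd : (W.quadraticTwist (NumberField.discr K : ℚ)).entireLFunction 1 ≠ 0)
    (hP : WeierstrassCurve.Affine.Point.map ι.toRatAlgHom P = heegnerPointComplex Dt H)
    (hC : ∃ C : VariableChange ℚ, C • W.quadraticTwist (NumberField.discr K : ℚ) = Wd)
    (hp2 : p ≠ 2) (hlo : IndexLowerBoundLeAt W p K P (padicValNat p Dt.c.natAbs))
    (hup : Upper.IndexUpperBoundLeAt W p K P (padicValNat p Dt.c.natAbs))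
    (hWd : BSDp Wd p) :
    BSDp W p := by
  obtain ⟨Cd, hCd⟩ := hC
  have hD0 : (NumberField.discr K : ℚ) ≠ 0 := by exact_mod_cast NumberField.discr_ne_zero K
  haveI : (W.quadraticTwist (NumberField.discr K : ℚ)).IsElliptic := W.isElliptic_quadraticTwist hD0
  have hLd1 : Wd.entireLFunction 1 ≠ 0 := by rw [← hCd, entireLFunction_smul]; exact hLd
  have hrd : Wd.analyticRank = 0 := analyticRank_eq_zero_of_entireLFunction_one_ne_zero Wd hLd1
  obtain ⟨-, hfin⟩ := hGZK Wd (by rw [hrd]; exact zero_le_one)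
  haveI : Finite Wd.sha := hfin
  obtain ⟨hdlo, hdup⟩ := lower_and_upper_of_missingPPartAt Wd p (missingPPartAt_of_bsdp Wd p hWd)
  exact bsdp_of_exactIndexManin_of_partner_halves hGZ hKo hGZK hmod hGZ73 W p N K Dt H ι P Wd hr hN hpN hK
    hodd hw hHH hLd hP ⟨Cd, hCd⟩ hp2 hlo hup hdlo hdup

end Summit.BirchSwinnertonDyer.BirchSwinnertonDyer.Theorems.SchneiderFree.Exact

end
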